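import Literature.AnabelianGeometry.SemiGraphs.CharacteristicOpenCore
import Literature.AnabelianGeometry.SemiGraphs.TemperoidsResProofs
import HarnessLib

/-!
# Characteristic open cores under continuous surjections and retractions; the core fixes every small
# finite continuous set

[cite: DixonEtAl1999, Prop 1.6] (finitely many open subgroups of each index in a topologically finitely
generated profinite group; the intersection of those of index `≤ d` is a characteristic open subgroup).
PROOF-ONLY complement (abc-iut cell, FRONTIER programme SUBDAG-REFUTE-F1732, brick R4 piece (B), seat
abc-iut-w4-d075; theorems only, no definition) to abc-iut-w4-d053's `CharacteristicOpenCore.lean`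
(`charOpenCore Γ d := sInf {U | IsOpen U ∧ 0 < U.index ∧ U.index ≤ d}`):

* `comap_mem_openSubgroupsIndexLE_of_surjective` / `charOpenCore_le_comap_of_surjective` /
  `map_charOpenCore_le_of_surjective` — a continuous SURJECTIVE homomorphism `χ : Γ → Γ'` carries
  `charOpenCore Γ d` into `charOpenCore Γ' d` (pull back the open subgroups of index `≤ d`);
* `comap_charOpenCore_le_of_leftInverse` — if `α : E → Γ` admits a continuous retraction `χ`
  (`χ ∘ α = id`), then `α⁻¹(charOpenCore Γ d) ≤ charOpenCore E d`;
* `ρ_eq_of_mem_charOpenCore` — `charOpenCore Γ d` acts trivially on every finite object of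
  `B^temp(Γ)` with at most `d` points (each point stabiliser is open of index `≤ d`).

Use (R4/(H5) of the countermodel programme): at a vertex group `G` with edge group `E ↪ G` split by a
character, ONE characteristic open subgroup of `G` controls the finite `G`-sets AND the finite `E`-sets
of bounded size simultaneously, and is preserved by every bi-continuous automorphism
(`map_charOpenCore_eq`).  Elementary; nothing here refers to the IUT corpus or takes a side on
[IUTchIII] Cor. 3.12.
-/

namespace Literature.AnabelianGeometry.SemiGraphs

open Topology

universe u v

section Functoriality

variable {Γ : Type u} [Group Γ] [TopologicalSpace Γ] {Γ' : Type v} [Group Γ'] [TopologicalSpace Γ']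

/-- Pulling back an open subgroup of index `≤ d` along a continuous surjection gives an open subgroup of
the same index. [cite: DixonEtAl1999, Prop 1.6] -/
theorem comap_mem_openSubgroupsIndexLE_of_surjective (χ : Γ →* Γ') (hχ : Continuous χ)
    (hsurj : Function.Surjective χ) {d : ℕ} {U : Subgroup Γ'} (hU : U ∈ openSubgroupsIndexLE Γ' d) :
    U.comap χ ∈ openSubgroupsIndexLE Γ d := by
  obtain ⟨hUo, hUi, hUd⟩ := hU
  refine ⟨hUo.preimage hχ, ?_, ?_⟩
  · rw [Subgroup.index_comap_of_surjective U hsurj]; exact hUi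
  · rw [Subgroup.index_comap_of_surjective U hsurj]; exact hUd

/-- A continuous surjection carries the characteristic open core into the characteristic open core
(pull-back form). [cite: DixonEtAl1999, Prop 1.6] -/
theorem charOpenCore_le_comap_of_surjective (χ : Γ →* Γ') (hχ : Continuous χ)
    (hsurj : Function.Surjective χ) (d : ℕ) : charOpenCore Γ d ≤ (charOpenCore Γ' d).comap χ := by
  intro g hg
  rw [Subgroup.mem_comap, charOpenCore, Subgroup.mem_sInf]
  intro U hU
  exact charOpenCore_le (comap_mem_openSubgroupsIndexLE_of_surjective χ hχ hsurj hU) hg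

/-- A continuous surjection carries the characteristic open core into the characteristic open core
(image form). [cite: DixonEtAl1999, Prop 1.6] -/
theorem map_charOpenCore_le_of_surjective (χ : Γ →* Γ') (hχ : Continuous χ)
    (hsurj : Function.Surjective χ) (d : ℕ) : (charOpenCore Γ d).map χ ≤ charOpenCore Γ' d :=
  Subgroup.map_le_iff_le_comap.mpr (charOpenCore_le_comap_of_surjective χ hχ hsurj d)

/-- **Retractions.**  If `α : E → Γ` has a continuous left inverse `χ : Γ → E` (`χ (α x) = x`), then the
pre-image under `α` of the characteristic open core of `Γ` lies in the characteristic open core of `E`: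
every open `U ≤ E` of index `≤ d` is `α⁻¹(χ⁻¹ U)` with `χ⁻¹ U` open of the same index in `Γ`.
[cite: DixonEtAl1999, Prop 1.6] -/
theorem comap_charOpenCore_le_of_leftInverse (α : Γ' →* Γ) (χ : Γ →* Γ') (hχ : Continuous χ)
    (hχα : ∀ x, χ (α x) = x) (d : ℕ) : (charOpenCore Γ d).comap α ≤ charOpenCore Γ' d := by
  have hsurj : Function.Surjective χ := fun x => ⟨α x, hχα x⟩
  have h1 : (charOpenCore Γ d).comap α ≤ ((charOpenCore Γ' d).comap χ).comap α :=
    Subgroup.comap_mono (charOpenCore_le_comap_of_surjective χ hχ hsurj d)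
  have h2 : ((charOpenCore Γ' d).comap χ).comap α = charOpenCore Γ' d := by
    rw [Subgroup.comap_comap]
    have hid : χ.comp α = MonoidHom.id Γ' := MonoidHom.ext hχα
    rw [hid, Subgroup.comap_id]
  exact h1.trans h2.le

end Functoriality

section Action

variable {Γ : Type u} [Group Γ] [TopologicalSpace Γ]

/-- The stabiliser of a point of a FINITE continuous `Γ`-set is an open subgroup of positive index at
most the number of points. [cite: DixonEtAl1999, Prop 1.6] -/
theorem stab_mem_openSubgroupsIndexLE (X : BTemp Γ) [Finite X.obj.V] (x : X.obj.V) {d : ℕ}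
    (hd : Nat.card X.obj.V ≤ d) : BTemp.stab X x ∈ openSubgroupsIndexLE Γ d := by
  letI : MulAction Γ X.obj.V := Action.instMulAction X.obj
  have hle : MulAction.stabilizer Γ x ≤ BTemp.stab X x := fun g hg => hg
  have hge : BTemp.stab X x ≤ MulAction.stabilizer Γ x := fun g hg => hg
  have hstab : BTemp.stab X x = MulAction.stabilizer Γ x := le_antisymm hge hle
  have h2 : (MulAction.stabilizer Γ x).index = Nat.card (MulAction.orbit Γ x) :=
    Nat.card_congr (MulAction.orbitEquivQuotientStabilizer Γ x).symm
  have h3 : Nat.card (MulAction.orbit Γ x) ≤ Nat.card X.obj.V :=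
    Nat.card_le_card_of_injective (fun y : MulAction.orbit Γ x => (y : X.obj.V)) Subtype.val_injective
  have h4 : Nat.card (MulAction.orbit Γ x) ≠ 0 :=
    Nat.card_ne_zero.mpr ⟨⟨⟨x, MulAction.mem_orbit_self x⟩⟩, inferInstance⟩
  refine ⟨X.property.2 x, ?_, ?_⟩
  · rw [hstab, h2]; exact Nat.pos_of_ne_zero h4
  · rw [hstab, h2]; exact h3.trans hd

/-- **The characteristic open core of level `d` acts trivially on every finite object of `B^temp(Γ)`
with at most `d` points.** [cite: DixonEtAl1999, Prop 1.6] -/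
theorem ρ_eq_of_mem_charOpenCore (X : BTemp Γ) [Finite X.obj.V] {d : ℕ} (hd : Nat.card X.obj.V ≤ d)
    {g : Γ} (hg : g ∈ charOpenCore Γ d) (x : X.obj.V) : X.obj.ρ g x = x :=
  charOpenCore_le (stab_mem_openSubgroupsIndexLE X x hd) hg

end Action

end Literature.AnabelianGeometry.SemiGraphs

-- (comment-only enqueue re-land 2026-08-26T10:44Z: STRANDED-ACCEPT remedy, bytes above byte-identical to p433739)
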